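import Summits.BirchSwinnertonDyer.BirchSwinnertonDyer.Theorems.SchneiderFreeAdditiveX3OrdinaryLineUnitRoot
import Summits.BirchSwinnertonDyer.Rank1Residual.X2.GreenbergVatsalReductionDatum
import Literature.NumberTheory.EllipticCurves.FrobeniusManinProofs
import Literature.NumberTheory.EllipticCurves.FrobeniusTateModule
import Literature.NumberTheory.EllipticCurves.HasseWeilGoodReductionFrobeniusProofs
import Literature.NumberTheory.EllipticCurves.PointDivisibilityProofs
import Literature.NumberTheory.EllipticCurves.OrdinaryReductionTateModuleProofs
import HarnessLib

/-!
# Frobenius acts on the reduction `Ẽ[p^k]` of a good ordinary `E/ℚ` as the unit root `α^n mod p^k`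
# (route `SchneiderFreeAdditiveX3`, seat `bsd-schneider-door-c6` gen 3; helper toward the
# «canonical line WITH ITS CHARACTER» of crux r5 `LocalTowerTorsionFiniteX3`,
# stmt-BirchSwinnertonDyer-19546 — FILE 1 of the (G-ord, `e = 2`) plan, part b)

For a globally minimal `E/ℚ`, a prime `p ∤ Δ_E` with `p ∤ a_p` and the place `v ∋ p`: every
`σ ∈ Γ_{ℚ_v}` of Frobenius degree `n` acts on `E(\bar ℚ_v)[p^k]` MODULO THE KERNEL OF REDUCTION as
the scalar `α^n mod p^k`, `α = unitRoot W p` the unit root of `X² − a_p X + p`: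
`red_v (σ Q) = (α^n mod p^k) • red_v Q` — the quotient `E[p^∞]/C_v ≅ Ẽ[p^∞]` of Greenberg's
ordinary datum is UNRAMIFIED with Frobenius `α` (Greenberg, LNM 1716, §2 p. 70: "the action of
`G_{ℚ_p}` on `Ẽ[p^∞]` is given by an unramified character `ψ`", `ψ(Frob_p) = α`).  Proof: the residue
map `r : 𝒪_w → \bar k_v` (`exists_residueMap`, `r(σ z) = r(z)^{p^n}`) carries `red_v ∘ σ` to
`φ^n ∘ red_v` for the `p`-power Frobenius `φ` of `\bar k_v`; Manin's relation
`φ² − a φ + p = 0` on `Ẽ(\bar k_v)` (`frobenius_sq_sub_trace_smul_add_card_smul`, `a = a_p` by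
`tr_integralModelInt_baseChange_eq_frobeniusTrace`), read on the CYCLIC group `Ẽ[p^k] = red_v(E[p^k])`
of order `p^k` of the ordinary reduction (`natCard_torsionBy_point_map_residue_le` + a point of
order `p^k`), says that the Frobenius scalar `u` there has `u² − a_p u + p ≡ 0 (mod p^k)` with
`p ∤ u`, hence `u ≡ α` (`toZModPow_intCast_eq_unitRoot`).

* `localRed_smul_eq_unitRoot_pow_smul_of_specVal` — the statement for `σ` with
  `|σ z − z^{p^n}|_v < 1` on the valuation ring (valuation form);
* `localRed_smul_eq_unitRoot_pow_smul` — the statement for `IsFrobPow σ n`.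

Proofs only (no definition, no named fact, no `sorry`); closes nothing by itself; BSD is not
advanced.  References: [GreenbergLNM1716] §2 p. 70; [SilvermanAEC2009] V.2.3.1(b), VII.2.1;
[MazurTateTeitelbaum1986Invent] §I.11.
-/

noncomputable section

open scoped Classical NNReal

open NumberField IsDedekindDomain Field Polynomial
open Literature.NumberTheory.EllipticCurves Literature.NumberTheory.EllipticCurves.GreenbergSelmer
  Literature.NumberTheory.GaloisRepresentations IsDedekindDomain.HeightOneSpectrum
  Summit.BirchSwinnertonDyer.Rank1Residual.X2.GreenbergVatsalReductionDatum
open WeierstrassCurve (minimalDiscriminantInt integralModelInt)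

universe u

namespace Summit.BirchSwinnertonDyer.BirchSwinnertonDyer.Theorems.SchneiderFreeAdditiveX3

set_option linter.dupNamespace false

section FrobScalar

variable (W : WeierstrassCurve ℚ) [W.IsGloballyMinimal] [W.IsElliptic] (p : ℕ) [hp : Fact p.Prime]
  {v : HeightOneSpectrum (𝓞 ℚ)}

set_option maxHeartbeats 800000 in
-- one long reduction-map bookkeeping proof (residue map, Manin's relation, ordinary filtration and
-- the scalar calculus share one local context)
/-- **Frobenius on the reduction is the unit root (valuation form).** For a globally minimal `E/ℚ`,
a prime `p ∤ Δ_E` with `p ∤ a_p`, the place `v ∋ p` and any level `k`: every `σ ∈ Γ_{ℚ_v}` acting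
on the residue field of `\bar ℚ_v` as the `p^n`-power map (`|σ z − z^{p^n}|_v < 1` on the valuation
ring of `specVal v`) acts on `E(\bar ℚ_v)[p^k]` MODULO THE KERNEL OF REDUCTION as the scalar
`α^n mod p^k`, `α = unitRoot W p` the unit root of `X² − a_p X + p`:
`red_v (σ Q) = (α^n mod p^k) • red_v Q`.  (Manin's `φ² − a_p φ + p = 0` on `Ẽ(\bar k_v)`, read on
the cyclic group `Ẽ[p^k]` of order `p^k` of the ORDINARY reduction: the Frobenius scalar `u` there
satisfies `u² − a_p u + p ≡ 0 (mod p^k)` and is prime to `p`, hence `u ≡ α`.)  Greenberg, LNM 1716,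
§2 p. 70 ("the action of `G_{ℚ_p}` on `Ẽ[p^∞]` is given by an unramified character `ψ`",
`ψ(Frob_p) = α`). [cite: GreenbergLNM1716, §2 p. 70] [cite: SilvermanAEC2009, Thm. V.2.3.1(b)] -/
theorem localRed_smul_eq_unitRoot_pow_smul_of_specVal (hpv : ((p : ℕ) : 𝓞 ℚ) ∈ v.asIdeal)
    (hΔ : ¬ (p : ℤ) ∣ minimalDiscriminantInt W) (hord : ¬ (p : ℤ) ∣ W.frobeniusTrace p) (k : ℕ)
    {σ : absoluteGaloisGroup (v.adicCompletion ℚ)} {n : ℕ}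
    (hσ : ∀ z : AlgebraicClosure (v.adicCompletion ℚ), specVal v z ≤ 1 →
      specVal v (σ • z - z ^ p ^ n) < 1)
    (Q : localPoints W (v.adicCompletion ℚ)) (hQ : ((p ^ k : ℕ) : ℤ) • Q = 0) :
    localRed W p hpv hΔ (σ • Q) =
      (PadicInt.toZModPow k (unitRoot W p ^ n)).val • localRed W p hpv hΔ Q := by
  -- NB: no `CharZero (ℚ_v)` instance is put in scope (cf. X2 `GreenbergVatsalReductionDatumLine`).
  have hw := specVal_spec v
  set red := localRed W p hpv hΔ with hred
  have hΔu := W.isUnit_Δ_localIntModel hpv (specVal_spec v) hΔ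
  have hvO : (specVal v).Integers (specVal v).valuationSubring :=
    Valuation.valuationSubring.integers (specVal v)
  have hMK := W.localIntModel_baseChange (specVal v).valuationSubring
  -- residue characteristic `p`
  have hpO : specVal v ((p : ℕ) : AlgebraicClosure (v.adicCompletion ℚ)) < 1 := by
    have h := spectralValuation_algebraMap_ringOfIntegers_lt_one (v := v) (specVal_spec v) hpv
    rwa [map_natCast] at h
  haveI hchar : CharP (IsLocalRing.ResidueField (specVal v).valuationSubring) p := by
    refine (CharP.charP_iff_prime_eq_zero hp.out).mpr ?_
    rw [← map_natCast (IsLocalRing.residue (specVal v).valuationSubring), IsLocalRing.residue_eq_zero_iff,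
      IsLocalRing.mem_maximalIdeal, mem_nonunits_iff, hvO.isUnit_iff_valuation_eq_one]
    exact fun h ↦ absurd h (ne_of_lt (by simpa using hpO))
  -- the ordinary filtration
  have hordA := W.exists_zsmul_eq_zero_localRed_ne_zero (specVal_spec v) hΔu red (fun _ ↦ rfl)
    hpv hΔ hord
  obtain ⟨P₁, hP₁p, hP₁red⟩ := hordA
  -- the residue map `r : 𝒪_w → k̄_v` and the Frobenius of `k_v`
  set kv := IsLocalRing.ResidueField (v.adicCompletionIntegers ℚ) with hkv
  haveI : Finite kv := finite_residueField_adicCompletionIntegers ℚ v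
  letI : Fintype kv := Fintype.ofFinite kv
  have hvp : (Rat.HeightOneSpectrum.primesEquiv v : ℕ) = p :=
    Rat.HeightOneSpectrum.primesEquiv_eq_of_natCast_mem v hp.out hpv
  have hq : Nat.card kv = p := by
    rw [hkv, WeierstrassCurve.natCard_residueField_adicCompletionIntegers v, hvp]
  have hqF : Fintype.card kv = p := by rw [← Nat.card_eq_fintype_card, hq]
  haveI hcharkv : CharP kv p := WeierstrassCurve.charP_residueField_adicCompletionIntegers (K := ℚ) hpv
  obtain ⟨𝔐, h𝔐⟩ := v.localPrimesAbove_nonempty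
  obtain ⟨r, hr0, -, hrF⟩ := exists_residueMap (specVal_spec v) h𝔐
  obtain ⟨φ, hφ⟩ := WeierstrassCurve.exists_frobenius_absoluteGaloisGroup kv
  have hφpow : ∀ (m : ℕ) (x : AlgebraicClosure kv), (φ ^ m) • x = x ^ (p ^ m) := by
    intro m
    induction m with
    | zero => intro x; rw [pow_zero, one_smul, pow_zero, pow_one]
    | succ m ih => intro x; rw [pow_succ, mul_smul, hφ, ih, hq, ← pow_mul, ← pow_succ']
  -- `r` factors through the residue field of `𝒪_w`
  have hker : ∀ a ∈ IsLocalRing.maximalIdeal (specVal v).valuationSubring, r a = 0 := by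
    intro a ha
    rw [IsLocalRing.mem_maximalIdeal, mem_nonunits_iff, hvO.isUnit_iff_valuation_eq_one] at ha
    exact (hr0 a).mpr (lt_of_le_of_ne ((Valuation.mem_valuationSubring_iff (specVal v) _).mp a.2) ha)
  let rt : IsLocalRing.ResidueField (specVal v).valuationSubring →+* AlgebraicClosure kv :=
    Ideal.Quotient.lift (IsLocalRing.maximalIdeal (specVal v).valuationSubring) r hker
  have hrt : ∀ a, rt (IsLocalRing.residue (specVal v).valuationSubring a) = r a := fun a ↦ Ideal.Quotient.lift_mk _ _ _
  -- the reduced curve and its model over the finite field `k_v`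
  set W₁ : WeierstrassCurve kv := (integralModelInt W).baseChange kv with hW₁
  haveI hW₁ell : W₁.IsElliptic := by
    refine ⟨?_⟩
    rw [hW₁, WeierstrassCurve.baseChange, WeierstrassCurve.map_Δ, isUnit_iff_ne_zero, ne_eq,
      eq_intCast, CharP.intCast_eq_zero_iff kv p]
    exact hΔ
  have hcurve : (((integralModelInt W).map (algebraMap ℤ ↥(specVal v).valuationSubring)).map (IsLocalRing.residue (specVal v).valuationSubring)).map rt = W₁.baseChange (AlgebraicClosure kv) := by
    rw [hW₁, WeierstrassCurve.baseChange, WeierstrassCurve.baseChange, WeierstrassCurve.map_map,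
      WeierstrassCurve.map_map, WeierstrassCurve.map_map]
    congr 1
    exact RingHom.ext_int _ _
  let Θ : (((integralModelInt W).map (algebraMap ℤ ↥(specVal v).valuationSubring)).map (IsLocalRing.residue (specVal v).valuationSubring)).toAffine.Point →+ W₁.geomPoints :=
    (WeierstrassCurve.Affine.Point.congrEquiv hcurve).toAddMonoidHom.comp
      ((((integralModelInt W).map (algebraMap ℤ ↥(specVal v).valuationSubring)).map (IsLocalRing.residue (specVal v).valuationSubring)).mapPointHom rt)
  have hΘinj : Function.Injective Θ :=
    (WeierstrassCurve.Affine.Point.congrEquiv hcurve).injective.comp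
      (WeierstrassCurve.mapPointHom_injective _ rt)
  have hΘsome : ∀ (x y : IsLocalRing.ResidueField (specVal v).valuationSubring) (h : (((integralModelInt W).map (algebraMap ℤ ↥(specVal v).valuationSubring)).map (IsLocalRing.residue (specVal v).valuationSubring)).toAffine.Nonsingular x y),
      ∃ h', Θ (.some x y h) = (.some (rt x) (rt y) h' : W₁.geomPoints) := by
    intro x y h
    exact ⟨_, by
      change WeierstrassCurve.Affine.Point.congrEquiv hcurve
        ((((integralModelInt W).map (algebraMap ℤ ↥(specVal v).valuationSubring)).map
          (IsLocalRing.residue (specVal v).valuationSubring)).mapPointHom rt (.some x y h)) = _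
      rw [WeierstrassCurve.mapPointHom_some, WeierstrassCurve.Affine.Point.congrEquiv_some]⟩
  -- the Galois action on affine geometric points of `W₁`
  have hsmul_some : ∀ (g : absoluteGaloisGroup kv) (a b : AlgebraicClosure kv)
      (h : (W₁.baseChange (AlgebraicClosure kv)).toAffine.Nonsingular a b),
      ∃ h', g • (show W₁.geomPoints from .some a b h) = .some (g • a) (g • b) h' := by
    intro g a b h
    have e : g • (show W₁.geomPoints from .some a b h) = WeierstrassCurve.Affine.Point.map
        ((show AlgebraicClosure kv ≃ₐ[kv] AlgebraicClosure kv from g) :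
          AlgebraicClosure kv →ₐ[kv] AlgebraicClosure kv) (.some a b h) := rfl
    rw [e, WeierstrassCurve.Affine.Point.map_some]
    exact ⟨_, rfl⟩
  -- `Θ ∘ red` intertwines an element of Frobenius degree `m` with `φ^m`
  have hredΘ : ∀ (τ : absoluteGaloisGroup (v.adicCompletion ℚ)) (m : ℕ),
      (∀ z : AlgebraicClosure (v.adicCompletion ℚ), specVal v z ≤ 1 → specVal v (τ • z - z ^ p ^ m) < 1) →
      ∀ Q : localPoints W (v.adicCompletion ℚ), Θ (red (τ • Q)) = (φ ^ m) • Θ (red Q) := by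
    intro τ m hτ Q
    rcases Q with _ | ⟨x, y, h⟩
    · change Θ (red (τ • (0 : localPoints W (v.adicCompletion ℚ)))) = (φ ^ m) • Θ (red 0)
      rw [smul_zero, map_zero, map_zero, smul_zero]
    · -- `τ • (x, y) = (τx, τy)`
      obtain ⟨h₂, hτP⟩ : ∃ h₂, τ • (show localPoints W (v.adicCompletion ℚ) from .some x y h) =
          .some (τ • x) (τ • y) h₂ :=
        ⟨_, by rw [localPoints.smul_def, WeierstrassCurve.Affine.Point.map_some]; rfl⟩
      rw [hτP]
      by_cases hx : specVal v x ≤ 1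
      · have hτx : specVal v (τ • x) ≤ 1 := by rwa [spectralValuation_smul hw]
        obtain ⟨hy, hns, e₁⟩ := reducePoint_congrEquiv_some_of_val_le_one hΔu hMK x y h hx
        obtain ⟨hτy, hnsτ, e₂⟩ := reducePoint_congrEquiv_some_of_val_le_one hΔu hMK _ _ h₂ hτx
        rw [hred, localRed_apply, localRed_apply]
        erw [e₁, e₂]
        obtain ⟨h₃, e₃⟩ := hΘsome _ _ hns
        obtain ⟨h₄, e₄⟩ := hΘsome _ _ hnsτ
        rw [e₃, e₄]
        obtain ⟨h₅, e₅⟩ := hsmul_some (φ ^ m) _ _ h₃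
        rw [e₅]
        -- coordinates: `r (τ z) = r z ^ (p^m) = φ^m (r z)`
        have key : ∀ (z : AlgebraicClosure (v.adicCompletion ℚ)) (hz : specVal v z ≤ 1) (hτz : specVal v (τ • z) ≤ 1),
            rt (IsLocalRing.residue (specVal v).valuationSubring ⟨τ • z, hτz⟩) = (φ ^ m) • rt (IsLocalRing.residue (specVal v).valuationSubring ⟨z, hz⟩) := by
          intro z hz hτz
          rw [hrt, hrt, hφpow, ← map_pow]
          have h0 : r ((⟨τ • z, (Valuation.mem_integer_iff _ _).mpr hτz⟩ : (specVal v).integer) -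
              (⟨z, (Valuation.mem_integer_iff _ _).mpr hz⟩ : (specVal v).integer) ^ p ^ m) = 0 := by
            rw [hr0]
            simpa only [AddSubgroupClass.coe_sub, SubmonoidClass.coe_pow] using hτ z hz
          rw [map_sub, sub_eq_zero] at h0
          exact h0
        exact point_some_congr (key x hx hτx) (key y hy (by rwa [spectralValuation_smul hw]))
      · -- non-integral: both reduce to `Õ`
        have hx' : 1 < specVal v x := not_le.mp hx
        have hτx' : 1 < specVal v (τ • x) := by rwa [spectralValuation_smul hw]
        have hz₁ : red (.some x y h) = 0 := by
          rw [hred, localRed_apply]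
          change goodReductionHom _ hvO hΔu _ = 0
          rw [goodReductionHom_eq_zero_iff, WeierstrassCurve.Affine.Point.congrEquiv_some,
            WeierstrassCurve.reducesToZero_some_iff, not_mem_range_iff hvO]
          exact hx'
        have hz₂ : red (.some (τ • x) (τ • y) h₂) = 0 := by
          rw [hred, localRed_apply]
          change goodReductionHom _ hvO hΔu _ = 0
          rw [goodReductionHom_eq_zero_iff, WeierstrassCurve.Affine.Point.congrEquiv_some,
            WeierstrassCurve.reducesToZero_some_iff, not_mem_range_iff hvO]
          exact hτx'
        rw [hz₁, hz₂, map_zero, smul_zero]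

  -- a local arithmetic Frobenius `σ₁` (Frobenius degree `1`)
  obtain ⟨σ₁, hσ₁⟩ := v.exists_isArithFrobAt_localAbsIntegers h𝔐
  have hσ₁' : ∀ z : AlgebraicClosure (v.adicCompletion ℚ), specVal v z ≤ 1 →
      specVal v (σ₁ • z - z ^ p ^ 1) < 1 := by
    intro z hz
    have hτz : specVal v (σ₁ • z) ≤ 1 := by rwa [spectralValuation_smul hw]
    have h := hrF hσ₁ ⟨z, (Valuation.mem_integer_iff _ _).mpr hz⟩ hτz
    rw [hq] at h
    have h0 : r ((⟨σ₁ • z, (Valuation.mem_integer_iff _ _).mpr hτz⟩ : (specVal v).integer) -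
        (⟨z, (Valuation.mem_integer_iff _ _).mpr hz⟩ : (specVal v).integer) ^ p) = 0 := by
      rw [map_sub, map_pow, sub_eq_zero]
      exact h
    rw [hr0] at h0
    rw [pow_one]
    simpa only [AddSubgroupClass.coe_sub, SubmonoidClass.coe_pow] using h0
  -- elliptic structure on `E(\bar ℚ_v)` (for divisibility)
  haveI hWL : (W.baseChange (AlgebraicClosure (v.adicCompletion ℚ))).IsElliptic :=
    inferInstanceAs ((W.map (algebraMap ℚ (AlgebraicClosure (v.adicCompletion ℚ)))).IsElliptic)
  -- `Γ` commutes with integer multiples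
  have hzs : ∀ (τ : absoluteGaloisGroup (v.adicCompletion ℚ)) (i : ℤ)
      (Q : localPoints W (v.adicCompletion ℚ)), τ • (i • Q) = i • (τ • Q) := fun τ i Q ↦
    map_zsmul (DistribSMul.toAddMonoidHom (localPoints W (v.adicCompletion ℚ)) τ) i Q
  have hzsφ : ∀ (g : absoluteGaloisGroup kv) (i : ℤ) (T : W₁.geomPoints), g • (i • T) = i • (g • T) :=
    fun g i T ↦ map_zsmul (DistribSMul.toAddMonoidHom W₁.geomPoints g) i T
  -- the trace of Frobenius of the reduction over `k_v` is `a_p`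
  set a : ℤ := W.frobeniusTrace p with ha
  have htr : Literature.NumberTheory.EllipticCurves.HasseManin.tr W₁ = a :=
    tr_integralModelInt_baseChange_eq_frobeniusTrace W p hpv
  -- MAIN STEP at level `p^(j+1)`
  have main : ∀ j : ℕ, ∃ u : ℤ, ¬ (p : ℤ) ∣ u ∧ ((p : ℤ) ^ (j + 1) ∣ u ^ 2 - a * u + p) ∧
      ∀ (τ : absoluteGaloisGroup (v.adicCompletion ℚ)) (m : ℕ),
        (∀ z : AlgebraicClosure (v.adicCompletion ℚ), specVal v z ≤ 1 →
          specVal v (τ • z - z ^ p ^ m) < 1) →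
        ∀ Q : localPoints W (v.adicCompletion ℚ), ((p ^ (j + 1) : ℕ) : ℤ) • Q = 0 →
          red (τ • Q) = (u ^ m) • red Q := by
    intro j
    have hpj0 : p ^ (j + 1) ≠ 0 := pow_ne_zero _ hp.out.ne_zero
    -- `Q₀` with `p^j Q₀ = P₁`; `y₀ = red Q₀` has order `p^(j+1)`
    obtain ⟨Q₀, hQ₀⟩ : ∃ Q₀ : localPoints W (v.adicCompletion ℚ), p ^ j • Q₀ = P₁ :=
      (W.baseChange (AlgebraicClosure (v.adicCompletion ℚ))).nsmul_surjective_of_isAlgClosed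
        (pow_ne_zero j hp.out.ne_zero) P₁
    have hQ₀k : p ^ (j + 1) • Q₀ = 0 := by
      rw [pow_succ, mul_nsmul, hQ₀, ← natCast_zsmul]
      exact hP₁p
    have hQ₀kz : ((p ^ (j + 1) : ℕ) : ℤ) • Q₀ = 0 := by rw [natCast_zsmul]; exact hQ₀k
    have hy₀ord : addOrderOf (red Q₀) = p ^ (j + 1) := by
      refine addOrderOf_eq_prime_pow (fun h0 ↦ hP₁red ?_) ?_
      · rw [← hQ₀, map_nsmul]; exact h0
      · rw [← map_nsmul, hQ₀k, map_zero]
    -- `Ẽ[p^(j+1)]` is generated by `y₀`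
    haveI hTfin : Finite (AddSubgroup.torsionBy
        (((integralModelInt W).map (algebraMap ℤ ↥(specVal v).valuationSubring)).map
          (IsLocalRing.residue (specVal v).valuationSubring)).toAffine.Point ((p ^ (j + 1) : ℕ) : ℤ)) :=
      finite_torsionBy_point_map_residue (specVal v).valuationSubring hΔu (by exact_mod_cast hpj0)
    have hTle := natCard_torsionBy_point_map_residue_le (specVal v).valuationSubring hΔu (p := p) (j + 1)
    have hST : AddSubgroup.zmultiples (red Q₀) = AddSubgroup.torsionBy
        (((integralModelInt W).map (algebraMap ℤ ↥(specVal v).valuationSubring)).map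
          (IsLocalRing.residue (specVal v).valuationSubring)).toAffine.Point ((p ^ (j + 1) : ℕ) : ℤ) := by
      refine AddSubgroup.eq_of_le_of_card_ge ?_ ?_
      · rw [AddSubgroup.zmultiples_le, mem_torsionBy_iff, natCast_zsmul, ← hy₀ord]
        exact addOrderOf_nsmul_eq_zero _
      · rw [Nat.card_zmultiples, hy₀ord]; exact hTle
    have hgen : ∀ y : (((integralModelInt W).map (algebraMap ℤ ↥(specVal v).valuationSubring)).map
        (IsLocalRing.residue (specVal v).valuationSubring)).toAffine.Point,
        ((p ^ (j + 1) : ℕ) : ℤ) • y = 0 → ∃ c : ℤ, c • red Q₀ = y := by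
      intro y hy
      have hmem : y ∈ AddSubgroup.zmultiples (red Q₀) := by
        rw [hST]; exact mem_torsionBy_iff.mpr hy
      exact AddSubgroup.mem_zmultiples_iff.mp hmem
    -- a Galois element acting on `y₀` by a scalar acts on all of `red(E[p^(j+1)])` by that scalar
    have hscalar : ∀ (τ : absoluteGaloisGroup (v.adicCompletion ℚ)) (c : ℤ),
        red (τ • Q₀) = c • red Q₀ →
        ∀ Q : localPoints W (v.adicCompletion ℚ), ((p ^ (j + 1) : ℕ) : ℤ) • Q = 0 →
          red (τ • Q) = c • red Q := by
      intro τ c hc Q hQ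
      obtain ⟨i, hi⟩ := hgen (red Q) (by rw [← map_zsmul, hQ, map_zero])
      have h1 : red (Q - i • Q₀) = 0 := by rw [map_sub, map_zsmul, hi, sub_self]
      have h2 : red (τ • (Q - i • Q₀)) = 0 := by
        rw [hred] at h1 ⊢
        exact (localRed_smul_eq_zero_iff W p hpv hΔ τ _).mpr h1
      rw [smul_sub, hzs, map_sub, map_zsmul, hc, sub_eq_zero] at h2
      rw [h2, ← hi, smul_smul, smul_smul, mul_comm]
    -- the Frobenius scalar `u` on `y₀`
    obtain ⟨u, hu⟩ := hgen (red (σ₁ • Q₀)) (by rw [← map_zsmul, ← hzs, hQ₀kz, smul_zero, map_zero])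
    -- Manin's relation at `T₀ = Θ y₀` (generalised to keep `Θ` opaque)
    obtain ⟨T₀, hT₀⟩ : ∃ T₀ : W₁.geomPoints, Θ (red Q₀) = T₀ := ⟨_, rfl⟩
    have hT₁ : φ • T₀ = u • T₀ := by
      have h := hredΘ σ₁ 1 hσ₁' Q₀
      rw [pow_one, ← hu, map_zsmul, hT₀] at h
      exact h.symm
    have hTm : ∀ m : ℕ, (φ ^ m) • T₀ = (u ^ m) • T₀ := by
      intro m
      induction m with
      | zero =>
        rw [pow_zero, pow_zero, one_zsmul]
        exact one_smul (absoluteGaloisGroup kv) T₀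
      | succ m ih =>
        rw [pow_succ, pow_succ', mul_zsmul, ← ih, ← hzsφ, ← hT₁]
        exact mul_smul (φ ^ m) φ T₀
    have hManin := W₁.frobenius_sq_sub_trace_smul_add_card_smul hφ T₀
    rw [hT₁, hzsφ, hT₁, smul_smul, hqF, htr, ← mul_zsmul] at hManin
    have hrel : (u * u - a * u + p) • red Q₀ = 0 := by
      apply hΘinj
      rw [map_zsmul, hT₀, map_zero, add_zsmul, sub_zsmul]
      exact hManin
    have hdvd : (p : ℤ) ^ (j + 1) ∣ u ^ 2 - a * u + p := by
      have h := addOrderOf_dvd_iff_zsmul_eq_zero.mpr hrel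
      rw [hy₀ord, Nat.cast_pow] at h
      rwa [sq]
    -- `u` is prime to `p`
    have hup : ¬ (p : ℤ) ∣ u := by
      intro hpu
      obtain ⟨i, hi⟩ := hgen (red (σ₁⁻¹ • Q₀))
        (by rw [← map_zsmul, ← hzs, hQ₀kz, smul_zero, map_zero])
      have h1 : red Q₀ = (u * i) • red Q₀ := by
        conv_lhs => rw [← smul_inv_smul σ₁ Q₀]
        rw [hscalar σ₁ u hu.symm (σ₁⁻¹ • Q₀)
          (by rw [← hzs, hQ₀kz, smul_zero]), ← hi, smul_smul]
      have h2 : (1 - u * i) • red Q₀ = 0 := by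
        rw [sub_zsmul, one_zsmul, ← h1]
        exact sub_self _
      have h3 := addOrderOf_dvd_iff_zsmul_eq_zero.mpr h2
      rw [hy₀ord, Nat.cast_pow] at h3
      have h4 : (p : ℤ) ∣ 1 - u * i := (dvd_pow_self (p : ℤ) (Nat.succ_ne_zero j)).trans h3
      have h5 : (p : ℤ) ∣ 1 := by
        have := h4.add (hpu.mul_right i)
        rwa [sub_add_cancel] at this
      exact hp.out.ne_one (by exact_mod_cast Int.eq_one_of_dvd_one (Int.natCast_nonneg p) h5)
    refine ⟨u, hup, hdvd, fun τ m hτ ↦ hscalar τ (u ^ m) ?_⟩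
    -- `red (τ Q₀) = u^m • y₀` via `Θ`
    obtain ⟨c, hc⟩ := hgen (red (τ • Q₀)) (by rw [← map_zsmul, ← hzs, hQ₀kz, smul_zero, map_zero])
    apply hΘinj
    rw [map_zsmul, hT₀, ← hTm m, ← hT₀]
    exact hredΘ τ m hτ Q₀
  -- level `k`: `k = 0` is trivial; at `k = j + 1` the scalar `u` is `≡ α (mod p^k)`
  rcases Nat.eq_zero_or_pos k with rfl | hk
  · rw [pow_zero, Nat.cast_one, one_smul] at hQ
    rw [hQ, smul_zero, map_zero, nsmul_zero]
  obtain ⟨j, rfl⟩ : ∃ j, k = j + 1 := ⟨k - 1, by omega⟩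
  obtain ⟨u, hup, hudvd, hu⟩ := main j
  rw [hu σ n hσ Q hQ]
  -- `u^n ≡ α^n (mod p^(j+1))`
  set N : ℕ := (PadicInt.toZModPow (j + 1) (unitRoot W p ^ n)).val with hN
  have hcong : ((u ^ n - N : ℤ) : ZMod (p ^ (j + 1))) = 0 := by
    have h1 : PadicInt.toZModPow (j + 1) ((u : ℤ_[p]) ^ n) =
        PadicInt.toZModPow (j + 1) (unitRoot W p ^ n) := by
      rw [map_pow, map_pow, toZModPow_intCast_eq_unitRoot W p hΔ hord (j + 1) u hudvd hup]
    rw [map_pow, map_intCast] at h1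
    push_cast
    rw [h1, hN, ZMod.natCast_zmod_val, sub_self]
  obtain ⟨c, hc⟩ := (ZMod.intCast_zmod_eq_zero_iff_dvd _ _).mp hcong
  have htor : ((p ^ (j + 1) : ℕ) : ℤ) • red Q = 0 := by rw [← map_zsmul, hQ, map_zero]
  have h1 : (u ^ n - (N : ℤ)) • red Q = 0 := by
    rw [hc, mul_comm, mul_zsmul, htor, zsmul_zero]
  have h2 : (u ^ n : ℤ) • red Q = (N : ℤ) • red Q := by
    rw [← sub_eq_zero, ← h1]
    simp only [sub_eq_add_neg, add_zsmul, neg_zsmul]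
  rw [h2, natCast_zsmul]

/-- **Frobenius on the reduction is the unit root.** For a globally minimal `E/ℚ`, a prime `p ∤ Δ_E`
with `p ∤ a_p`, the place `v ∋ p` and any level `k`: every `σ ∈ Γ_{ℚ_v}` of Frobenius degree `n`
(`IsFrobPow σ n`) acts on `E(\bar ℚ_v)[p^k]` modulo the kernel of reduction as `α^n mod p^k`,
`α = unitRoot W p`: `red_v (σ Q) = (α^n mod p^k) • red_v Q` — the quotient `Ẽ[p^∞]` of `E[p^∞]` by
Greenberg's ordinary line is unramified with Frobenius `α` (Greenberg, LNM 1716, §2 p. 70).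
[cite: GreenbergLNM1716, §2 p. 70] [cite: SilvermanAEC2009, Thm. V.2.3.1(b)] -/
theorem localRed_smul_eq_unitRoot_pow_smul (hpv : ((p : ℕ) : 𝓞 ℚ) ∈ v.asIdeal)
    (hΔ : ¬ (p : ℤ) ∣ minimalDiscriminantInt W) (hord : ¬ (p : ℤ) ∣ W.frobeniusTrace p) (k : ℕ)
    {σ : absoluteGaloisGroup (v.adicCompletion ℚ)} {n : ℕ} (hσ : IsFrobPow σ (n : ℤ))
    (Q : localPoints W (v.adicCompletion ℚ)) (hQ : ((p ^ k : ℕ) : ℤ) • Q = 0) :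
    localRed W p hpv hΔ (σ • Q) =
      (PadicInt.toZModPow k (unitRoot W p ^ n)).val • localRed W p hpv hΔ Q :=
  localRed_smul_eq_unitRoot_pow_smul_of_specVal W p hpv hΔ hord k
    (specVal_smul_sub_pow_lt_one_of_isFrobPow p hpv hσ) Q hQ

end FrobScalar

end Summit.BirchSwinnertonDyer.BirchSwinnertonDyer.Theorems.SchneiderFreeAdditiveX3

end
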